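import Mathlib
import Summits.NavierStokesRegularity.OSWSelfSimilar.SheetNSLineTorusCascadeLink
import HarnessLib

/-!
# Viscous CLM on the torus (`a = 0`, `σ = 2`): the PDE link for GENERAL odd data with nonnegative analytic-signal
# coefficients — every classical solution whose datum has first coefficient `a₁ ≥ 48ν` fails to exist on `[0, log 2/ν]`

HONEST FRAMING (cell ns-blowup GROUP B «PROFILE SEARCH», zone Z3, row Z3-U addendum A-F2 of `HOME/profile/z3/CENSUS-Z3.md`;
human rulings D-0035/D-0074): **1-D MODEL (viscous Constantin–Lax–Majda equation `ω_t = ω·Hω + ν ω_xx` on `𝕋`,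
`H = hilbertTransformCircle`); kernel-checked; not Euler, not Navier–Stokes; «violates: none — MODEL».**

`SheetNSLineTorusCascadeLink` is typed for the sine datum `−c sin x`. Here the datum is ANY slice whose cascade variables at
`t = 0` are real and nonnegative, `coef ω k 0 = a_k ∈ ℝ_{≥0}` (`k ∈ ℕ`, `a_0 = 0`) — i.e. `ω(0,·)` has mean zero and analytic
signal `Hω₀ − iω₀ = Σ_{k≥1} a_k e^{ikx}` with `a_k ≥ 0` (odd data `ω₀ = −Σ a_k sin kx`). For a classical solution on `[0, T]`:

* (private re-runs of the sine-datum proofs with the datum hypothesis replaced: mean zero propagated, the complex cascade on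
  `(0, T)`, realness — private because their conclusions coincide with the landed sine versions);
* `coef_re_nonneg_gen` — the real cascade variables stay `≥ 0` on `[0, T]`;
* **`sine_le_coef_re`** — FINITE-HORIZON COMPARISON: the explicit sine cascade with `c = a_1` lies below,
  `cascadeSolution ν (sineDatum a₁) k t ≤ Re c_k(t)` on `[0, T]` (strong induction; `e^{νk²t}(Re c_k − s_k)` non-decreasing);
* **`horizon_lt_log_two_div_gen`** — `0 < ν`, `48ν ≤ a₁` ⇒ `T < log 2/ν`: **no classical solution from such a datum survives to
  `t = log 2/ν`** (sine unboundedness `cascadeSolution_sine_unbounded_of_le` + the uniform mode bound `exists_abs_coef_re_le`);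
* `horizon_lt_of_sine_unbounded_gen` — the transfer slot: unboundedness of the sine cascade with `c = a₁` at `τ` (a certificate)
  ⇒ `T < τ`.

bears_on: LADDER-NS N5 / zone Z3 (row Z3-U, A-F2) → N1 linear core. WHAT THIS IS NOT: not NS; no existence statement for general
data here (the synthesis files cover geometric envelopes); data with coefficients of both signs are not covered.
-/

noncomputable section

namespace Summit.NavierStokesRegularity.OSWSelfSimilar
namespace SheetNSLineTorusCascade

open Finset Real Set Filter MeasureTheory intervalIntegral Complex
open Literature.Analysis.Fourier
open scoped Topology

/-! ### Calculus helpers (private copies) -/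

/-- A real function continuous on `[a, b]` with zero derivative on `(a, b)` is constant on `[a, b]`. [folklore] -/
private theorem eq_of_hasDerivAt_zero' {φ : ℝ → ℝ} {a b : ℝ} (hc : ContinuousOn φ (Icc a b))
    (hd : ∀ t ∈ Ioo a b, HasDerivAt φ 0 t) {t : ℝ} (ht : t ∈ Icc a b) : φ t = φ a := by
  have hab : a ≤ b := ht.1.trans ht.2
  have hmono : MonotoneOn φ (Icc a b) :=
    monotoneOn_of_hasDerivWithinAt_nonneg (f' := fun _ => 0) (convex_Icc a b) hc
      (by rw [interior_Icc]; exact fun x hx => (hd x hx).hasDerivWithinAt) (by intros; exact le_rfl)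
  have hanti : AntitoneOn φ (Icc a b) :=
    antitoneOn_of_hasDerivWithinAt_nonpos (f' := fun _ => 0) (convex_Icc a b) hc
      (by rw [interior_Icc]; exact fun x hx => (hd x hx).hasDerivWithinAt) (by intros; exact le_rfl)
  have ha : a ∈ Icc a b := left_mem_Icc.2 hab
  exact le_antisymm (hanti ha ht ht.1) (hmono ha ht ht.1)

/-- The imaginary part of a complex function with derivative `D` has derivative `D.im`. [folklore] -/
private theorem hasDerivAt_im' {ψ : ℝ → ℂ} {D : ℂ} {t : ℝ} (hψ : HasDerivAt ψ D t) :
    HasDerivAt (fun s => (ψ s).im) D.im t := by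
  rw [show (fun s => (ψ s).im) = Complex.imCLM ∘ ψ from rfl]
  exact (Complex.imCLM.hasFDerivAt.comp_hasDerivAt t hψ).congr_deriv (by simp)

/-- The real part of a complex function with derivative `D` has derivative `D.re`. [folklore] -/
private theorem hasDerivAt_re' {ψ : ℝ → ℂ} {D : ℂ} {t : ℝ} (hψ : HasDerivAt ψ D t) :
    HasDerivAt (fun s => (ψ s).re) D.re t := by
  rw [show (fun s => (ψ s).re) = Complex.reCLM ∘ ψ from rfl]
  exact (Complex.reCLM.hasFDerivAt.comp_hasDerivAt t hψ).congr_deriv (by simp)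

/-! ### The link for general nonnegative data -/

section general

variable {ν T : ℝ} {ω ωt ωx ωxx : ℝ → ℝ → ℝ} (h : IsClassicalSolution ν T ω ωt ωx ωxx)
  {a : ℕ → ℝ} (hdat : ∀ k : ℕ, coef ω k 0 = ((a k : ℝ) : ℂ)) (ha : ∀ k, 0 ≤ a k) (hmean : mode ω 0 0 = 0)
include h hmean

/-- **Mean zero is propagated** (general datum with `mode ω 0 0 = 0`): `mode ω 0 t = 0` on `[0, T]`. [new here — MODEL] -/
private theorem mode_zero_eq_zero_gen {t : ℝ} (ht : t ∈ Icc (0 : ℝ) T) : mode ω 0 t = 0 := by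
  have hT : 0 ≤ T := ht.1.trans ht.2
  -- zero derivative on `(0, T)`
  have hd : ∀ s ∈ Ioo (0 : ℝ) T, HasDerivAt (mode ω 0) 0 s := by
    intro s hs
    have hs' : s ∈ Icc (0 : ℝ) T := Ioo_subset_Icc_self hs
    have h1 := hasDerivAt_mode h hs 0
    rw [modeCoeff_slice_t h hs 0, modeCoeff_slice_xx h hs' 0] at h1
    have hP : modeCoeff (2 * π) 0
        (fun x => ((ω s x : ℝ) : ℂ) * ((hilbertTransformCircle (ω s) x : ℝ) : ℂ)) = 0 := by
      have hS := hasSum_conv_sgn h hs' ((0 : ℕ) : ℤ)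
      have h0 := conv_sgn_zero hS
      have hπ : ((2 * π : ℝ) : ℂ) ≠ 0 := by exact_mod_cast (by positivity : (2 * π : ℝ) ≠ 0)
      simpa [I_ne_zero, hπ] using h0
    simpa [hP] using h1
  have hcont : ContinuousOn (mode ω 0) (Icc 0 T) := continuousOn_mode h hT 0
  -- real and imaginary parts are constant
  have hcre : ContinuousOn (fun s => (mode ω 0 s).re) (Icc 0 T) := Complex.continuous_re.comp_continuousOn hcont
  have hcim : ContinuousOn (fun s => (mode ω 0 s).im) (Icc 0 T) := Complex.continuous_im.comp_continuousOn hcont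
  have hre : (mode ω 0 t).re = (mode ω 0 0).re :=
    eq_of_hasDerivAt_zero' hcre (fun s hs => by simpa using hasDerivAt_re' (hd s hs)) ht
  have him : (mode ω 0 t).im = (mode ω 0 0).im :=
    eq_of_hasDerivAt_zero' hcim (fun s hs => by simpa using hasDerivAt_im' (hd s hs)) ht
  rw [hmean] at hre him
  exact Complex.ext (by simpa using hre) (by simpa using him)


/-- `coef ω 0 t = 0` on `[0, T]` (general datum). -/
private theorem coef_zero_eq_zero_gen {t : ℝ} (ht : t ∈ Icc (0 : ℝ) T) : coef ω 0 t = 0 := by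
  rw [coef, Nat.cast_zero, mode_zero_eq_zero_gen h hmean ht, mul_zero]


/-- **The complex cascade** on `(0, T)` for a general mean-zero datum: `d/dt c_k = ½ Σ_{i+j=k} c_i c_j − ν k² c_k`.
[new here — MODEL] -/
private theorem hasDerivAt_coef_gen {t : ℝ} (ht : t ∈ Ioo (0 : ℝ) T) (k : ℕ) :
    HasDerivAt (coef ω k)
      (((1 / 2 : ℝ) : ℂ) * (∑ p ∈ antidiagonal k, coef ω p.1 t * coef ω p.2 t)
        - ((ν * (k : ℝ) ^ 2 : ℝ) : ℂ) * coef ω k t) t := by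
  have ht' : t ∈ Icc (0 : ℝ) T := Ioo_subset_Icc_self ht
  -- the pairing sum at mode `k`
  set S : ℂ := ∑ j ∈ range (k + 1), mode ω j t * mode ω ((k : ℤ) - j) t with hSdef
  have hS : I * (((2 * π : ℝ) : ℂ) * modeCoeff (2 * π) k
      (fun x => ((ω t x : ℝ) : ℂ) * ((hilbertTransformCircle (ω t) x : ℝ) : ℂ))) = S :=
    conv_sgn_eq_sum_range (a := fun l => mode ω l t) k (mode_zero_eq_zero_gen h hmean ht') (hasSum_conv_sgn h ht' k)
  -- the antidiagonal sum of `coef` is `−S/π²`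
  have hanti : ∑ p ∈ antidiagonal k, coef ω p.1 t * coef ω p.2 t = -(1 / (π : ℂ) ^ 2) * S := by
    rw [hSdef, Finset.Nat.sum_antidiagonal_eq_sum_range_succ_mk, mul_sum]
    refine sum_congr rfl fun j hj => ?_
    rw [Finset.mem_range] at hj
    simp only [coef]
    rw [Nat.cast_sub (by omega : j ≤ k)]
    have hπ : (π : ℂ) ≠ 0 := by exact_mod_cast Real.pi_ne_zero
    field_simp
    rw [Complex.I_sq]
    ring
  -- derivative of `mode k`, through the equation
  have h1 := hasDerivAt_mode h ht k
  rw [modeCoeff_slice_t h ht k, modeCoeff_slice_xx h ht' k] at h1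
  have h2 := h1.const_mul (-(I / π))
  have hπ : (π : ℂ) ≠ 0 := by exact_mod_cast Real.pi_ne_zero
  have h2π : ((2 * π : ℝ) : ℂ) ≠ 0 := by exact_mod_cast (by positivity : (2 * π : ℝ) ≠ 0)
  -- `P = S / (2π I)`
  have hP : modeCoeff (2 * π) k (fun x => ((ω t x : ℝ) : ℂ) * ((hilbertTransformCircle (ω t) x : ℝ) : ℂ))
      = S / (I * ((2 * π : ℝ) : ℂ)) := by
    rw [← hS]; field_simp
  refine h2.congr_deriv ?_
  rw [hP, hanti]
  simp only [coef]
  push_cast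
  field_simp
  ring


/-- The weighted variable `e^{νk²t} c_k` has derivative `e^{νk²t}·½Σ_{i+j=k} c_i c_j` on `(0, T)` (general datum). -/
private theorem hasDerivAt_weighted_coef_gen {t : ℝ} (ht : t ∈ Ioo (0 : ℝ) T) (k : ℕ) :
    HasDerivAt (fun s => ((Real.exp (ν * (k : ℝ) ^ 2 * s) : ℝ) : ℂ) * coef ω k s)
      (((Real.exp (ν * (k : ℝ) ^ 2 * t) : ℝ) : ℂ) *
        (((1 / 2 : ℝ) : ℂ) * ∑ p ∈ antidiagonal k, coef ω p.1 t * coef ω p.2 t)) t := by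
  have he : HasDerivAt (fun s => ((Real.exp (ν * (k : ℝ) ^ 2 * s) : ℝ) : ℂ))
      (((Real.exp (ν * (k : ℝ) ^ 2 * t) * (ν * (k : ℝ) ^ 2) : ℝ) : ℂ)) t := by
    have h1 : HasDerivAt (fun s => Real.exp (ν * (k : ℝ) ^ 2 * s)) (Real.exp (ν * (k : ℝ) ^ 2 * t) * (ν * (k : ℝ) ^ 2)) t := by
      have := ((hasDerivAt_id t).const_mul (ν * (k : ℝ) ^ 2)).exp
      simpa using this
    exact h1.ofReal_comp
  refine (he.mul (hasDerivAt_coef_gen h hmean ht k)).congr_deriv ?_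
  push_cast
  ring


include hdat in
/-- **Realness** for a datum with real cascade variables: `Im c_k ≡ 0` on `[0, T]`. [new here — MODEL] -/
private theorem coef_im_eq_zero_gen : ∀ k : ℕ, ∀ t ∈ Icc (0 : ℝ) T, (coef ω k t).im = 0 := by
  intro k
  induction k using Nat.strong_induction_on with
  | _ k ih =>
    intro t ht
    have hT : 0 ≤ T := ht.1.trans ht.2
    set ψ : ℝ → ℂ := fun s => ((Real.exp (ν * (k : ℝ) ^ 2 * s) : ℝ) : ℂ) * coef ω k s with hψ
    -- `Im ψ` has zero derivative on `(0, T)`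
    have hd : ∀ s ∈ Ioo (0 : ℝ) T, HasDerivAt (fun s => (ψ s).im) 0 s := by
      intro s hs
      have hs' : s ∈ Icc (0 : ℝ) T := Ioo_subset_Icc_self hs
      have h1 := hasDerivAt_im' (hasDerivAt_weighted_coef_gen h hmean hs k)
      have hzero : (∑ p ∈ antidiagonal k, coef ω p.1 s * coef ω p.2 s).im = 0 := by
        rw [Complex.im_sum]
        refine sum_eq_zero fun p hp => ?_
        have hsum : p.1 + p.2 = k := mem_antidiagonal.mp hp
        rcases Nat.eq_zero_or_pos p.1 with h0 | h0
        · rw [h0, coef_zero_eq_zero_gen h hmean hs', zero_mul, Complex.zero_im]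
        rcases Nat.eq_zero_or_pos p.2 with h2 | h2
        · rw [h2, coef_zero_eq_zero_gen h hmean hs', mul_zero, Complex.zero_im]
        rw [Complex.mul_im, ih p.1 (by omega) s hs', ih p.2 (by omega) s hs']
        ring
      have hval : ((((Real.exp (ν * (k : ℝ) ^ 2 * s) : ℝ) : ℂ) *
          (((1 / 2 : ℝ) : ℂ) * ∑ p ∈ antidiagonal k, coef ω p.1 s * coef ω p.2 s))).im = 0 := by
        rw [Complex.im_ofReal_mul, Complex.im_ofReal_mul, hzero, mul_zero, mul_zero]
      rw [hval] at h1
      exact h1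
    -- continuity of `Im ψ` on `[0, T]`
    have hcont : ContinuousOn (fun s => (ψ s).im) (Icc 0 T) := by
      refine Complex.continuous_im.comp_continuousOn ?_
      refine ((continuous_ofReal.comp (Real.continuous_exp.comp (continuous_const.mul continuous_id))).continuousOn).mul ?_
      exact (continuousOn_mode h hT k).const_smul (-(I / π)) |>.congr fun s _ => by simp [coef, smul_eq_mul]
    have hconst := eq_of_hasDerivAt_zero' hcont hd ht
    -- the datum is real
    have hinit : (ψ 0).im = 0 := by
      simp only [hψ, mul_zero, Real.exp_zero, Complex.ofReal_one, one_mul]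
      rw [hdat k, Complex.ofReal_im]
    rw [hinit] at hconst
    -- unweight
    have hexp : (0 : ℝ) < Real.exp (ν * (k : ℝ) ^ 2 * t) := Real.exp_pos _
    have : (ψ t).im = Real.exp (ν * (k : ℝ) ^ 2 * t) * (coef ω k t).im := by
      simp only [hψ, Complex.im_ofReal_mul]
    rw [this] at hconst
    exact (mul_eq_zero.mp hconst).resolve_left hexp.ne'


include hdat ha in
/-- **The real cascade variables stay nonnegative** on `[0, T]` (strong induction: `e^{νk²t} Re c_k` is non-decreasing).
[new here — MODEL] -/
theorem coef_re_nonneg_gen : ∀ k : ℕ, ∀ t ∈ Icc (0 : ℝ) T, 0 ≤ (coef ω k t).re := by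
  intro k
  induction k using Nat.strong_induction_on with
  | _ k ih =>
    intro t ht
    have hT : 0 ≤ T := ht.1.trans ht.2
    set φ : ℝ → ℝ := fun s => ((((Real.exp (ν * (k : ℝ) ^ 2 * s) : ℝ) : ℂ) * coef ω k s)).re with hφ
    have hmono : MonotoneOn φ (Icc 0 T) := by
      refine monotoneOn_of_hasDerivWithinAt_nonneg (convex_Icc 0 T) ?_ (f' := fun s =>
        ((((Real.exp (ν * (k : ℝ) ^ 2 * s) : ℝ) : ℂ) *
          (((1 / 2 : ℝ) : ℂ) * ∑ p ∈ antidiagonal k, coef ω p.1 s * coef ω p.2 s))).re) ?_ ?_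
      · refine Complex.continuous_re.comp_continuousOn ?_
        refine ((continuous_ofReal.comp (Real.continuous_exp.comp (continuous_const.mul continuous_id))).continuousOn).mul ?_
        exact (continuousOn_mode h hT k).const_smul (-(I / π)) |>.congr fun s _ => by simp [coef, smul_eq_mul]
      · rw [interior_Icc]; intro s hs
        exact (hasDerivAt_re' (hasDerivAt_weighted_coef_gen h hmean hs k)).hasDerivWithinAt
      · rw [interior_Icc]; intro s hs
        have hs' : s ∈ Icc (0 : ℝ) T := Ioo_subset_Icc_self hs
        rw [Complex.re_ofReal_mul, Complex.re_ofReal_mul, Complex.re_sum]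
        refine mul_nonneg (Real.exp_pos _).le (mul_nonneg (by norm_num) (sum_nonneg fun p hp => ?_))
        have hsum : p.1 + p.2 = k := mem_antidiagonal.mp hp
        rcases Nat.eq_zero_or_pos p.1 with h0 | h0
        · rw [h0, coef_zero_eq_zero_gen h hmean hs', zero_mul, Complex.zero_re]
        rcases Nat.eq_zero_or_pos p.2 with h2 | h2
        · rw [h2, coef_zero_eq_zero_gen h hmean hs', mul_zero, Complex.zero_re]
        rw [Complex.mul_re, coef_im_eq_zero_gen h hdat hmean p.1 s hs', coef_im_eq_zero_gen h hdat hmean p.2 s hs',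
          mul_zero, sub_zero]
        exact mul_nonneg (ih p.1 (by omega) s hs') (ih p.2 (by omega) s hs')
    have h0 : φ 0 = a k := by
      simp only [hφ, mul_zero, Real.exp_zero, Complex.ofReal_one, one_mul, hdat k, Complex.ofReal_re]
    have hle := hmono (left_mem_Icc.2 hT) ht ht.1
    rw [h0] at hle
    have hφt : φ t = Real.exp (ν * (k : ℝ) ^ 2 * t) * (coef ω k t).re := by
      simp only [hφ, Complex.re_ofReal_mul]
    rw [hφt] at hle
    have hexp : 0 < Real.exp (ν * (k : ℝ) ^ 2 * t) := Real.exp_pos _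
    nlinarith [ha k]

include hdat ha in
/-- **Finite-horizon comparison with the sine cascade.** With `s = cascadeSolution ν (sineDatum (a 1))` (the explicit sine
cascade with the same first coefficient): `s_k(t) ≤ Re c_k(t)` for all `k` and `t ∈ [0, T]`. [new here — MODEL] -/
theorem sine_le_coef_re : ∀ k : ℕ, ∀ t ∈ Icc (0 : ℝ) T,
    cascadeSolution ν (sineDatum (a 1)) k t ≤ (coef ω k t).re := by
  have hs := isSineCascade_cascadeSolution ν (a 1)
  intro k
  induction k using Nat.strong_induction_on with
  | _ k ih =>
    intro t ht
    have hT : 0 ≤ T := ht.1.trans ht.2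
    set s := cascadeSolution ν (sineDatum (a 1)) with hsdef
    set D : ℝ → ℝ := fun r => ((((Real.exp (ν * (k : ℝ) ^ 2 * r) : ℝ) : ℂ) * coef ω k r)).re
      - Real.exp (ν * (k : ℝ) ^ 2 * r) * s k r with hD
    have hmono : MonotoneOn D (Icc 0 T) := by
      refine monotoneOn_of_hasDerivWithinAt_nonneg (convex_Icc 0 T) ?_ (f' := fun r =>
        ((((Real.exp (ν * (k : ℝ) ^ 2 * r) : ℝ) : ℂ) *
          (((1 / 2 : ℝ) : ℂ) * ∑ p ∈ antidiagonal k, coef ω p.1 r * coef ω p.2 r))).re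
        - Real.exp (ν * (k : ℝ) ^ 2 * r) * ((1 / 2) * ∑ p ∈ antidiagonal k, s p.1 r * s p.2 r)) ?_ ?_
      · refine ContinuousOn.sub ?_ ?_
        · refine Complex.continuous_re.comp_continuousOn ?_
          refine ((continuous_ofReal.comp (Real.continuous_exp.comp (continuous_const.mul continuous_id))).continuousOn).mul ?_
          exact (continuousOn_mode h hT k).const_smul (-(I / π)) |>.congr fun r _ => by simp [coef, smul_eq_mul]
        · exact ((Real.continuous_exp.comp (continuous_const.mul continuous_id)).continuousOn).mul
            ((hs.cont k).mono Icc_subset_Ici_self)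
      · rw [interior_Icc]; intro r hr
        exact ((hasDerivAt_re' (hasDerivAt_weighted_coef_gen h hmean hr k)).sub
          (SheetNSLineTorusCascade.hasDerivAt_weighted hs k hr.1)).hasDerivWithinAt
      · rw [interior_Icc]; intro r hr
        have hr' : r ∈ Icc (0 : ℝ) T := Ioo_subset_Icc_self hr
        rw [Complex.re_ofReal_mul, Complex.re_ofReal_mul, Complex.re_sum, ← mul_sub, ← mul_sub, ← sum_sub_distrib]
        refine mul_nonneg (Real.exp_pos _).le (mul_nonneg (by norm_num) (sum_nonneg fun p hp => ?_))
        have hsum : p.1 + p.2 = k := mem_antidiagonal.mp hp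
        rcases Nat.eq_zero_or_pos p.1 with h0 | h0
        · rw [h0, coef_zero_eq_zero_gen h hmean hr', hs.zero]; simp
        rcases Nat.eq_zero_or_pos p.2 with h2 | h2
        · rw [h2, coef_zero_eq_zero_gen h hmean hr', hs.zero]; simp
        rw [Complex.mul_re, coef_im_eq_zero_gen h hdat hmean p.1 r hr', coef_im_eq_zero_gen h hdat hmean p.2 r hr',
          mul_zero, sub_zero, sub_nonneg]
        exact mul_le_mul (ih p.1 (by omega) r hr') (ih p.2 (by omega) r hr') (nonneg hs (ha 1) _ r hr'.1)
          (coef_re_nonneg_gen h hdat ha hmean p.1 r hr')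
    have hD0 : 0 ≤ D 0 := by
      simp only [hD, mul_zero, Real.exp_zero, Complex.ofReal_one, one_mul, hdat k, Complex.ofReal_re,
        hsdef, cascadeSolution_init]
      rcases Nat.lt_or_ge k 2 with hk | hk
      · interval_cases k
        · simp [sineDatum, ha 0]
        · simp [sineDatum]
      · rw [sineDatum_of_two_le _ hk]; linarith [ha k]
    have hle := le_trans hD0 (hmono (left_mem_Icc.2 hT) ht ht.1)
    have hDt : D t = Real.exp (ν * (k : ℝ) ^ 2 * t) * ((coef ω k t).re - s k t) := by
      simp only [hD, Complex.re_ofReal_mul]; ring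
    rw [hDt] at hle
    have hexp : 0 < Real.exp (ν * (k : ℝ) ^ 2 * t) := Real.exp_pos _
    nlinarith

include hdat ha in
/-- **No classical solution from a large nonnegative datum survives to `t = log 2/ν`.** For `0 < ν` and `48ν ≤ a₁`: `T < log 2/ν`.
[new here — MODEL] -/
theorem horizon_lt_log_two_div_gen (hν : 0 < ν) (hc : 48 * ν ≤ a 1) : T < Real.log 2 / ν := by
  by_contra hcon
  have hle : Real.log 2 / ν ≤ T := not_lt.mp hcon
  have hlog : 0 < Real.log 2 / ν := div_pos (Real.log_pos (by norm_num)) hν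
  obtain ⟨M, hM⟩ := exists_abs_coef_re_le h (t := Real.log 2 / ν) ⟨hlog.le, hle⟩
  obtain ⟨k, hk⟩ := cascadeSolution_sine_unbounded_of_le hν hc M
  have h1 := sine_le_coef_re h hdat ha hmean k _ ⟨hlog.le, hle⟩
  exact absurd ((le_abs_self _).trans (hM k)) (not_le.mpr (lt_of_lt_of_le hk h1))

include hdat ha in
/-- **Transfer slot.** Unboundedness of the sine cascade with `c = a₁` at a time `τ > 0` (a certificate, for `a₁` above the
certified threshold) ⇒ every classical solution from the datum has `T < τ`. [new here — MODEL] -/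
theorem horizon_lt_of_sine_unbounded_gen {τ : ℝ} (hτ : 0 < τ)
    (hunb : ∀ M : ℝ, ∃ k : ℕ, M < cascadeSolution ν (sineDatum (a 1)) k τ) : T < τ := by
  by_contra hcon
  have hle : τ ≤ T := not_lt.mp hcon
  obtain ⟨M, hM⟩ := exists_abs_coef_re_le h (t := τ) ⟨hτ.le, hle⟩
  obtain ⟨k, hk⟩ := hunb M
  have h1 := sine_le_coef_re h hdat ha hmean k _ ⟨hτ.le, hle⟩
  exact absurd ((le_abs_self _).trans (hM k)) (not_le.mpr (lt_of_lt_of_le hk h1))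

end general

/-- Consistency: the sine datum `−c sin x` (`c ≥ 0`) satisfies the general hypotheses with `a = sineDatum c`. -/
theorem coef_zero_sineDatum {ω : ℝ → ℝ → ℝ} {c : ℝ} (hω0 : ∀ x, ω 0 x = -c * Real.sin x) :
    ∀ k : ℕ, coef ω k 0 = ((sineDatum c k : ℝ) : ℂ) := by
  intro k
  rcases Nat.lt_or_ge k 2 with hk | hk
  · interval_cases k
    · rw [coef, Nat.cast_zero, mode_zero_zero hω0]; simp [sineDatum]
    · rw [coef_one_zero hω0]; simp [sineDatum]
  · rw [coef_zero_of_two_le hω0 hk, sineDatum_of_two_le c hk]; simp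

end SheetNSLineTorusCascade
end Summit.NavierStokesRegularity.OSWSelfSimilar
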